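import Summits.AnomalousDissipation.AnomalousDissipation.Theorems.TwoAndHalfDTwohalfdNegCondensate
import Summits.AnomalousDissipation.AnomalousDissipation.Theorems.TwoAndHalfDTwohalfdNegCondensateRenormalisationSobolev

/-!
# Condensate theorem for the crux `TwoAndHalfD.TwohalfdNeg` (stmt-AnomalousDissipation-0211):
# Sobolev condensates and condensation onto rest

Line `log-kantorovich-enstrophy-transfer`, lead c6, wave 2.  Corollaries of the condensate theorem
(`TwoAndHalfDTwohalfdNegCondensate`: `scalarNoAnomaly_of_condensate_of_renorm`) with the renormalisation step
supplied by the registered stub `stub_condensateRenormalisationSobolev` (DiPerna–Lions for `Θ ∈ L²`, `∇V ∈ L²`):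

* `twohalfdNeg_family_of_condensate_of_renorm` — the crux form with the renormalisation property of `V` abstracted;
* `scalarNoAnomaly_of_condensate_sobolev`, `twohalfdNeg_family_of_condensate_sobolev` — the planar and crux forms for a
  steady field `V ∈ C⁰ ∩ H¹`, weakly divergence free (vortex-patch-type steady condensates);
* `scalarNoAnomaly_of_vanishing_planar_energy`, `twohalfdNeg_family_of_vanishing_planar_energy` — condensation onto
  REST (`V = 0`): a family whose planar `limsup`-mean energy tends to `0` has `meanDissipation → 0`.

Closes with the registered tools stub `stub_condensateCertificateSobolev`.  Supports stmt-AnomalousDissipation-0211.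
-/

namespace Summit.AnomalousDissipation.AnomalousDissipation.Theorems.TwohalfdNeg.Condensate

open MeasureTheory Filter Topology Set
open scoped ENNReal NNReal InnerProductSpace
open Literature.Analysis.FunctionSpaces Literature.Analysis.FluidPDE
open Summit.AnomalousDissipation.AnomalousDissipation.Theorems.TwohalfdNeg

set_option linter.dupNamespace false

/-! ## Sobolev condensates: `V ∈ C⁰ ∩ H¹` weakly divergence-free (wave 2) -/

/-- **The crux form, renormalisation abstracted.** As `twohalfdNeg_family_of_condensate`, for a merely
continuous steady planar field `V` granted its steady renormalisation property for every smooth source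
(`∀ h smooth, ∀ Θ' ∈ L², div(Θ'V) = h ⇒ ∫Θ'h = 0`). [folklore] -/
theorem twohalfdNeg_family_of_condensate_of_renorm :
    ∀ f : UnitAddTorus (Fin 3) → EuclideanSpace ℝ (Fin 3),
      (∀ (s : UnitAddCircle) (x : UnitAddTorus (Fin 3)), f (x + Pi.single (2 : Fin 3) s) = f x) →
      Torus.IsSmooth f → Torus.IsDivFree f → Torus.HasZeroMean f →
      ∀ V : UnitAddTorus (Fin 2) → EuclideanSpace ℝ (Fin 2), Continuous V →
      (∀ h : UnitAddTorus (Fin 2) → ℝ, Torus.IsSmooth h → ∀ Θ' : UnitAddTorus (Fin 2) → ℝ, MemLp Θ' 2 volume →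
        (∀ φ : UnitAddTorus (Fin 2) → ℝ, Torus.IsSmooth φ →
          (∫ x, Θ' x * inner ℝ (V x) (Torus.gradient φ x)) + ∫ x, h x * φ x = 0) →
        ∫ x, Θ' x * h x = 0) →
      ∀ (ν : ℕ → ℝ) (u₀ : ℕ → UnitAddTorus (Fin 3) → EuclideanSpace ℝ (Fin 3))
        (u : ℕ → ℝ → UnitAddTorus (Fin 3) → EuclideanSpace ℝ (Fin 3)),
        (∀ j, 0 < ν j) → Tendsto ν atTop (𝓝 0) →
        (∀ j, Torus.IsGlobalLerayHopf (ν j) (fun _ => f) (u₀ j) (u j)) →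
        (∀ j (t : ℝ) (s : UnitAddCircle) (x : UnitAddTorus (Fin 3)),
          u j t (x + Pi.single (2 : Fin 3) s) = u j t x) →
        (∃ E : ℝ, ∀ j, meanEnergy (u j) ≤ E) →
        Tendsto (fun j => longTimeAvgSup (fun t =>
          ∫ x, ‖Torus.planarProjE (u j t x) - V (Torus.planarProj x)‖ ^ 2)) atTop (𝓝 0) →
        Tendsto (fun j => meanDissipation (ν j) (u j)) atTop (𝓝 0) := by
  intro f hfinv hfs hfd hfz V hVc hR ν u₀ u hν hν0 hLH huinv hE hcond
  obtain ⟨g, h, v₀, v, θ₀, θ, hgs, hgd, hgz, hhs, hhz, -, huv, hvLH, hθ₀, hθw, hEv, hEθ, hsplit⟩ :=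
    ReductionOffZero.stub_reductionOffZero f hfinv hfs hfd hfz ν u₀ u hν hLH huinv hE
  have hplanar : Tendsto (fun j => meanDissipation (ν j) (v j)) atTop (𝓝 0) :=
    PlanarNoAnomaly.stub_planarNoAnomaly g hgs hgd hgz ν v₀ v hν hν0 hvLH hEv
  -- the condensation hypothesis read on the planar flow
  have hcond' : Tendsto (fun j => longTimeAvgSup (fun t => ∫ y, ‖v j t y - V y‖ ^ 2)) atTop (𝓝 0) := by
    refine hcond.congr fun j => ?_
    unfold longTimeAvgSup
    refine limsup_congr ?_
    filter_upwards [eventually_gt_atTop (0 : ℝ)] with T hT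
    unfold timeMean
    congr 1
    refine intervalIntegral.integral_congr_ae (Eventually.of_forall fun t ht => ?_)
    rw [Set.uIoc_of_le hT.le] at ht
    rw [huv j t ht.1.ne']
    exact integral_norm_sq_planarProjE_twoHalf_sub (θ j t)
      (((hvLH j) (t + 1) (by linarith [ht.1])).memLp t ⟨ht.1.le, by linarith⟩).1 hVc
  have hscalar : Tendsto (fun j => longTimeAvgSup
      (fun t => ν j * (Torus.eScalarGradNormSq (θ j t)).toReal)) atTop (𝓝 0) :=
    scalarNoAnomaly_of_condensate_of_renorm g h V hgs hgz hhs hhz hVc (hR h hhs) ν v₀ v θ₀ θ hν hν0 hvLH hcond'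
      hθ₀ hθw hEθ
  have hsum : Tendsto (fun j => meanDissipation (ν j) (v j) +
      longTimeAvgSup (fun t => ν j * (Torus.eScalarGradNormSq (θ j t)).toReal)) atTop (𝓝 0) := by
    simpa using hplanar.add hscalar
  exact squeeze_zero (fun j => meanDissipation_nonneg (hν j).le (u j)) hsplit hsum

/-- **The planar condensate theorem for Sobolev condensates.** As `scalarNoAnomaly_of_condensate`, with the
steady field `V` only continuous, weakly divergence-free and in `H¹` (`eGradNormSq V < ⊤`; e.g. the velocity
of a steady vortex patch): the renormalisation is the registered stub `stub_condensateRenormalisationSobolev`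
(DiPerna–Lions with `Θ ∈ L²`, `∇V ∈ L²`). [folklore] -/
theorem scalarNoAnomaly_of_condensate_sobolev :
    ∀ (g : UnitAddTorus (Fin 2) → EuclideanSpace ℝ (Fin 2)) (h : UnitAddTorus (Fin 2) → ℝ)
      (V : UnitAddTorus (Fin 2) → EuclideanSpace ℝ (Fin 2)),
      Torus.IsSmooth g → Torus.HasZeroMean g → Torus.IsSmooth h → Torus.HasZeroMean h →
      Continuous V → Torus.IsWeaklyDivFree V → Torus.eGradNormSq V < ⊤ →
      ∀ (ν : ℕ → ℝ) (v₀ : ℕ → UnitAddTorus (Fin 2) → EuclideanSpace ℝ (Fin 2))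
        (v : ℕ → ℝ → UnitAddTorus (Fin 2) → EuclideanSpace ℝ (Fin 2))
        (θ₀ : ℕ → UnitAddTorus (Fin 2) → ℝ) (θ : ℕ → ℝ → UnitAddTorus (Fin 2) → ℝ),
        (∀ j, 0 < ν j) → Tendsto ν atTop (𝓝 0) →
        (∀ j, Torus.IsGlobalLerayHopf (ν j) (fun _ => g) (v₀ j) (v j)) →
        Tendsto (fun j => longTimeAvgSup (fun t => ∫ x, ‖v j t x - V x‖ ^ 2)) atTop (𝓝 0) →
        (∀ j, MemLp (θ₀ j) 2 volume) →
        (∀ j, Torus.IsWeakScalarTransportForced (ν j) (v j) (fun _ => h) (θ₀ j) (θ j)) →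
        (∃ E : ℝ, ∀ j, longTimeAvgSup (fun t => Torus.scalarL2Sq (θ j t)) ≤ E) →
        Tendsto (fun j => longTimeAvgSup (fun t => ν j * (Torus.eScalarGradNormSq (θ j t)).toReal))
          atTop (𝓝 0) :=
  fun g h V hgs hgz hhs hhz hVc hVd hVH =>
    scalarNoAnomaly_of_condensate_of_renorm g h V hgs hgz hhs hhz hVc
      fun Θ' hΘ'm hΘ'eq => stub_condensateRenormalisationSobolev V h Θ' hVc hVd hVH hhs hΘ'm hΘ'eq

/-- **The crux `TwohalfdNeg` on families condensing onto a Sobolev steady field** (`V ∈ C⁰ ∩ H¹` weakly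
divergence free; e.g. vortex-patch-type steady condensates): `meanDissipation → 0`. [folklore] -/
theorem twohalfdNeg_family_of_condensate_sobolev :
    ∀ f : UnitAddTorus (Fin 3) → EuclideanSpace ℝ (Fin 3),
      (∀ (s : UnitAddCircle) (x : UnitAddTorus (Fin 3)), f (x + Pi.single (2 : Fin 3) s) = f x) →
      Torus.IsSmooth f → Torus.IsDivFree f → Torus.HasZeroMean f →
      ∀ V : UnitAddTorus (Fin 2) → EuclideanSpace ℝ (Fin 2),
        Continuous V → Torus.IsWeaklyDivFree V → Torus.eGradNormSq V < ⊤ →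
      ∀ (ν : ℕ → ℝ) (u₀ : ℕ → UnitAddTorus (Fin 3) → EuclideanSpace ℝ (Fin 3))
        (u : ℕ → ℝ → UnitAddTorus (Fin 3) → EuclideanSpace ℝ (Fin 3)),
        (∀ j, 0 < ν j) → Tendsto ν atTop (𝓝 0) →
        (∀ j, Torus.IsGlobalLerayHopf (ν j) (fun _ => f) (u₀ j) (u j)) →
        (∀ j (t : ℝ) (s : UnitAddCircle) (x : UnitAddTorus (Fin 3)),
          u j t (x + Pi.single (2 : Fin 3) s) = u j t x) →
        (∃ E : ℝ, ∀ j, meanEnergy (u j) ≤ E) →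
        Tendsto (fun j => longTimeAvgSup (fun t =>
          ∫ x, ‖Torus.planarProjE (u j t x) - V (Torus.planarProj x)‖ ^ 2)) atTop (𝓝 0) →
        Tendsto (fun j => meanDissipation (ν j) (u j)) atTop (𝓝 0) :=
  fun f hfinv hfs hfd hfz V hVc hVd hVH =>
    twohalfdNeg_family_of_condensate_of_renorm f hfinv hfs hfd hfz V hVc
      fun h hhs Θ' hΘ'm hΘ'eq => stub_condensateRenormalisationSobolev V h Θ' hVc hVd hVH hhs hΘ'm hΘ'eq

/-! ## Condensation onto rest: vanishing planar energy -/

/-- The zero planar field is divergence free. [folklore] -/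
theorem isDivFree_zero_planar : Torus.IsDivFree (fun _ : UnitAddTorus (Fin 2) => (0 : EuclideanSpace ℝ (Fin 2))) := by
  intro x
  simp [Torus.divergence, Torus.partialDeriv, Torus.lineDeriv]

/-- **Vanishing planar energy kills the steady-source scalar anomaly.** A planar Leray–Hopf family whose
`limsup`-mean kinetic energy tends to `0` (condensation onto REST) carries every steadily sourced
bounded-variance weak scalar with `⟨ν_j‖∇θ_j‖²⟩ → 0`: `scalarNoAnomaly_of_condensate` with `V = 0`.  (With a
nonzero source `h` such families in fact carry NO bounded-variance scalar — the limit mean equation would force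
`h = 0` — so the statement is the honest `Tendsto` form of that exclusion.) [folklore] -/
theorem scalarNoAnomaly_of_vanishing_planar_energy :
    ∀ (g : UnitAddTorus (Fin 2) → EuclideanSpace ℝ (Fin 2)) (h : UnitAddTorus (Fin 2) → ℝ),
      Torus.IsSmooth g → Torus.HasZeroMean g → Torus.IsSmooth h → Torus.HasZeroMean h →
      ∀ (ν : ℕ → ℝ) (v₀ : ℕ → UnitAddTorus (Fin 2) → EuclideanSpace ℝ (Fin 2))
        (v : ℕ → ℝ → UnitAddTorus (Fin 2) → EuclideanSpace ℝ (Fin 2))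
        (θ₀ : ℕ → UnitAddTorus (Fin 2) → ℝ) (θ : ℕ → ℝ → UnitAddTorus (Fin 2) → ℝ),
        (∀ j, 0 < ν j) → Tendsto ν atTop (𝓝 0) →
        (∀ j, Torus.IsGlobalLerayHopf (ν j) (fun _ => g) (v₀ j) (v j)) →
        Tendsto (fun j => longTimeAvgSup (fun t => ∫ x, ‖v j t x‖ ^ 2)) atTop (𝓝 0) →
        (∀ j, MemLp (θ₀ j) 2 volume) →
        (∀ j, Torus.IsWeakScalarTransportForced (ν j) (v j) (fun _ => h) (θ₀ j) (θ j)) →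
        (∃ E : ℝ, ∀ j, longTimeAvgSup (fun t => Torus.scalarL2Sq (θ j t)) ≤ E) →
        Tendsto (fun j => longTimeAvgSup (fun t => ν j * (Torus.eScalarGradNormSq (θ j t)).toReal))
          atTop (𝓝 0) := by
  intro g h hgs hgz hhs hhz ν v₀ v θ₀ θ hν hν0 hLH hK
  refine scalarNoAnomaly_of_condensate g h (fun _ => 0) hgs hgz hhs hhz (Torus.isSmooth_const _)
    isDivFree_zero_planar ν v₀ v θ₀ θ hν hν0 hLH ?_
  simpa only [sub_zero] using hK

/-- **The crux `TwohalfdNeg` on families with vanishing planar energy** (all the energy eventually in the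
vertical component): `meanDissipation → 0`; `twohalfdNeg_family_of_condensate` with `V = 0`. [folklore] -/
theorem twohalfdNeg_family_of_vanishing_planar_energy :
    ∀ f : UnitAddTorus (Fin 3) → EuclideanSpace ℝ (Fin 3),
      (∀ (s : UnitAddCircle) (x : UnitAddTorus (Fin 3)), f (x + Pi.single (2 : Fin 3) s) = f x) →
      Torus.IsSmooth f → Torus.IsDivFree f → Torus.HasZeroMean f →
      ∀ (ν : ℕ → ℝ) (u₀ : ℕ → UnitAddTorus (Fin 3) → EuclideanSpace ℝ (Fin 3))
        (u : ℕ → ℝ → UnitAddTorus (Fin 3) → EuclideanSpace ℝ (Fin 3)),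
        (∀ j, 0 < ν j) → Tendsto ν atTop (𝓝 0) →
        (∀ j, Torus.IsGlobalLerayHopf (ν j) (fun _ => f) (u₀ j) (u j)) →
        (∀ j (t : ℝ) (s : UnitAddCircle) (x : UnitAddTorus (Fin 3)),
          u j t (x + Pi.single (2 : Fin 3) s) = u j t x) →
        (∃ E : ℝ, ∀ j, meanEnergy (u j) ≤ E) →
        Tendsto (fun j => longTimeAvgSup (fun t => ∫ x, ‖Torus.planarProjE (u j t x)‖ ^ 2)) atTop (𝓝 0) →
        Tendsto (fun j => meanDissipation (ν j) (u j)) atTop (𝓝 0) := by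
  intro f hfinv hfs hfd hfz ν u₀ u hν hν0 hLH huinv hE hK
  refine twohalfdNeg_family_of_condensate f hfinv hfs hfd hfz (fun _ => 0) (Torus.isSmooth_const _)
    isDivFree_zero_planar ν u₀ u hν hν0 hLH huinv hE ?_
  simpa only [sub_zero] using hK

/-- **Registered tools stub `stub_condensateCertificateSobolev`** (registered on stmt-AnomalousDissipation-0211 with
`ledger workitem stub-add`): the Sobolev planar/crux forms and the vanishing-planar-energy planar/crux forms. [folklore] -/
theorem stub_condensateCertificateSobolev :
    (∀ (g : UnitAddTorus (Fin 2) → EuclideanSpace ℝ (Fin 2)) (h : UnitAddTorus (Fin 2) → ℝ)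
      (V : UnitAddTorus (Fin 2) → EuclideanSpace ℝ (Fin 2)),
      Torus.IsSmooth g → Torus.HasZeroMean g → Torus.IsSmooth h → Torus.HasZeroMean h →
      Continuous V → Torus.IsWeaklyDivFree V → Torus.eGradNormSq V < ⊤ →
      ∀ (ν : ℕ → ℝ) (v₀ : ℕ → UnitAddTorus (Fin 2) → EuclideanSpace ℝ (Fin 2))
        (v : ℕ → ℝ → UnitAddTorus (Fin 2) → EuclideanSpace ℝ (Fin 2))
        (θ₀ : ℕ → UnitAddTorus (Fin 2) → ℝ) (θ : ℕ → ℝ → UnitAddTorus (Fin 2) → ℝ),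
        (∀ j, 0 < ν j) → Tendsto ν atTop (𝓝 0) →
        (∀ j, Torus.IsGlobalLerayHopf (ν j) (fun _ => g) (v₀ j) (v j)) →
        Tendsto (fun j => longTimeAvgSup (fun t => ∫ x, ‖v j t x - V x‖ ^ 2)) atTop (𝓝 0) →
        (∀ j, MemLp (θ₀ j) 2 volume) →
        (∀ j, Torus.IsWeakScalarTransportForced (ν j) (v j) (fun _ => h) (θ₀ j) (θ j)) →
        (∃ E : ℝ, ∀ j, longTimeAvgSup (fun t => Torus.scalarL2Sq (θ j t)) ≤ E) →
        Tendsto (fun j => longTimeAvgSup (fun t => ν j * (Torus.eScalarGradNormSq (θ j t)).toReal))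
          atTop (𝓝 0)) ∧
    (∀ f : UnitAddTorus (Fin 3) → EuclideanSpace ℝ (Fin 3),
      (∀ (s : UnitAddCircle) (x : UnitAddTorus (Fin 3)), f (x + Pi.single (2 : Fin 3) s) = f x) →
      Torus.IsSmooth f → Torus.IsDivFree f → Torus.HasZeroMean f →
      ∀ V : UnitAddTorus (Fin 2) → EuclideanSpace ℝ (Fin 2),
        Continuous V → Torus.IsWeaklyDivFree V → Torus.eGradNormSq V < ⊤ →
      ∀ (ν : ℕ → ℝ) (u₀ : ℕ → UnitAddTorus (Fin 3) → EuclideanSpace ℝ (Fin 3))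
        (u : ℕ → ℝ → UnitAddTorus (Fin 3) → EuclideanSpace ℝ (Fin 3)),
        (∀ j, 0 < ν j) → Tendsto ν atTop (𝓝 0) →
        (∀ j, Torus.IsGlobalLerayHopf (ν j) (fun _ => f) (u₀ j) (u j)) →
        (∀ j (t : ℝ) (s : UnitAddCircle) (x : UnitAddTorus (Fin 3)),
          u j t (x + Pi.single (2 : Fin 3) s) = u j t x) →
        (∃ E : ℝ, ∀ j, meanEnergy (u j) ≤ E) →
        Tendsto (fun j => longTimeAvgSup (fun t =>
          ∫ x, ‖Torus.planarProjE (u j t x) - V (Torus.planarProj x)‖ ^ 2)) atTop (𝓝 0) →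
        Tendsto (fun j => meanDissipation (ν j) (u j)) atTop (𝓝 0)) ∧
    (∀ (g : UnitAddTorus (Fin 2) → EuclideanSpace ℝ (Fin 2)) (h : UnitAddTorus (Fin 2) → ℝ),
      Torus.IsSmooth g → Torus.HasZeroMean g → Torus.IsSmooth h → Torus.HasZeroMean h →
      ∀ (ν : ℕ → ℝ) (v₀ : ℕ → UnitAddTorus (Fin 2) → EuclideanSpace ℝ (Fin 2))
        (v : ℕ → ℝ → UnitAddTorus (Fin 2) → EuclideanSpace ℝ (Fin 2))
        (θ₀ : ℕ → UnitAddTorus (Fin 2) → ℝ) (θ : ℕ → ℝ → UnitAddTorus (Fin 2) → ℝ),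
        (∀ j, 0 < ν j) → Tendsto ν atTop (𝓝 0) →
        (∀ j, Torus.IsGlobalLerayHopf (ν j) (fun _ => g) (v₀ j) (v j)) →
        Tendsto (fun j => longTimeAvgSup (fun t => ∫ x, ‖v j t x‖ ^ 2)) atTop (𝓝 0) →
        (∀ j, MemLp (θ₀ j) 2 volume) →
        (∀ j, Torus.IsWeakScalarTransportForced (ν j) (v j) (fun _ => h) (θ₀ j) (θ j)) →
        (∃ E : ℝ, ∀ j, longTimeAvgSup (fun t => Torus.scalarL2Sq (θ j t)) ≤ E) →
        Tendsto (fun j => longTimeAvgSup (fun t => ν j * (Torus.eScalarGradNormSq (θ j t)).toReal))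
          atTop (𝓝 0)) ∧
    (∀ f : UnitAddTorus (Fin 3) → EuclideanSpace ℝ (Fin 3),
      (∀ (s : UnitAddCircle) (x : UnitAddTorus (Fin 3)), f (x + Pi.single (2 : Fin 3) s) = f x) →
      Torus.IsSmooth f → Torus.IsDivFree f → Torus.HasZeroMean f →
      ∀ (ν : ℕ → ℝ) (u₀ : ℕ → UnitAddTorus (Fin 3) → EuclideanSpace ℝ (Fin 3))
        (u : ℕ → ℝ → UnitAddTorus (Fin 3) → EuclideanSpace ℝ (Fin 3)),
        (∀ j, 0 < ν j) → Tendsto ν atTop (𝓝 0) →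
        (∀ j, Torus.IsGlobalLerayHopf (ν j) (fun _ => f) (u₀ j) (u j)) →
        (∀ j (t : ℝ) (s : UnitAddCircle) (x : UnitAddTorus (Fin 3)),
          u j t (x + Pi.single (2 : Fin 3) s) = u j t x) →
        (∃ E : ℝ, ∀ j, meanEnergy (u j) ≤ E) →
        Tendsto (fun j => longTimeAvgSup (fun t => ∫ x, ‖Torus.planarProjE (u j t x)‖ ^ 2)) atTop (𝓝 0) →
        Tendsto (fun j => meanDissipation (ν j) (u j)) atTop (𝓝 0)) :=
  ⟨scalarNoAnomaly_of_condensate_sobolev, twohalfdNeg_family_of_condensate_sobolev,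
    scalarNoAnomaly_of_vanishing_planar_energy, twohalfdNeg_family_of_vanishing_planar_energy⟩

end Summit.AnomalousDissipation.AnomalousDissipation.Theorems.TwohalfdNeg.Condensate
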